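import Literature.AlgebraicGeometry.Motives.MixedHodgeStructureIndecomposableEndLocal
import Literature.AlgebraicGeometry.Motives.MixedHodgeStructureSplitOverQExtensions
import HarnessLib

/-!
# The Krull–Schmidt exchange lemma for mixed Hodge structures (two summands)

In the abelian category of mixed Hodge structures (Cattani–El Zein–Griffiths–Lê, *Hodge Theory*, Thm. 3.2.18;
semisimple objects p. 270), objects on finite-dimensional spaces have finite length, indecomposable objects have
local endomorphism rings (the tree's `MixedHodgeStructureIndecomposableEndLocal`), and the Krull–Schmidt theorem
holds. This file proves its two working parts and the two-summand case:

* §1 **`IsIndecomposable.bijective_of_comp_bijective`**: if `T` is indecomposable, `S ≠ 0`, and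
  `S —e→ T —d→ S` composes to an isomorphism, then `e` (and `d`) are isomorphisms — an indecomposable object has no
  proper non-zero direct summand.
* §2 the projections of a decomposition `H = S ⊕ S'` (`coe_projOfIsCompl_add_coe_projOfIsCompl`), and the
  **exchange lemma** `IsIndecomposable.bijective_proj_comp_subtype_or`: for `H = S ⊕ S' = T ⊕ T'` with `S, T, T'`
  indecomposable, the projection to `T` or the projection to `T'` restricts to an isomorphism on `S`.
* §3 consequences: the iso `S ⥲ T` forces `H = S ⊕ T'` (`isCompl_of_bijective_proj_comp_subtype`), complements of
  the same sub-MHS are isomorphic (`bijective_proj_comp_subtype_of_isCompl_of_isCompl`), and **`krullSchmidt_two`**: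
  `(S ≅ T ∧ S' ≅ T') ∨ (S ≅ T' ∧ S' ≅ T)`.

Namespace `MixedHodgeStructure`; everything proved, no named facts.

## References

* [CattaniElZeinGriffithsLe2014] E. Cattani et al. (eds.), Hodge Theory (2014), Thm. 3.2.18, p. 270.
-/

noncomputable section

namespace Literature.AlgebraicGeometry.Motives

namespace MixedHodgeStructure

universe u v w

variable {V : Type u} [AddCommGroup V] [Module ℚ V] [FiniteDimensional ℚ V]
variable {H : MixedHodgeStructure V}

open Module

/-! ### §1 An indecomposable object has no proper non-zero direct summand -/

section Summand

variable {VS : Type v} [AddCommGroup VS] [Module ℚ VS] [FiniteDimensional ℚ VS]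
variable {VT : Type w} [AddCommGroup VT] [Module ℚ VT] [FiniteDimensional ℚ VT]
variable {HS : MixedHodgeStructure VS} {HT : MixedHodgeStructure VT}

omit [FiniteDimensional ℚ VS] in
/-- **If `T` is indecomposable, `S ≠ 0` and `d ∘ e : S → T → S` is an isomorphism, then `e` is an isomorphism**
(`g = e (de)⁻¹ d` is an idempotent endomorphism of `T`, hence `0` or bijective by Fitting; it is not `0` as
`d g e = d e ≠ 0`; a bijective idempotent is the identity, so `e` is onto).
[cite: CattaniElZeinGriffithsLe2014, Thm. 3.2.18 and p. 270] -/
theorem IsIndecomposable.bijective_of_comp_bijective [Nontrivial VS] (hT : HT.IsIndecomposable) (e : Hom HS HT)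
    (d : Hom HT HS) (h : Function.Bijective (d.comp e).toLinearMap) : Function.Bijective e.toLinearMap := by
  let u : Hom HS HS := (d.comp e).inverse h
  let g : Hom HT HT := e.comp (u.comp d)
  have hude : ∀ x, u.toLinearMap (d.toLinearMap (e.toLinearMap x)) = x := fun x => by
    change (((d.comp e).inverse h).comp (d.comp e)).toLinearMap x = x
    rw [Hom.inverse_comp]; rfl
  have hg : ∀ y, g.toLinearMap y = e.toLinearMap (u.toLinearMap (d.toLinearMap y)) := fun _ => rfl
  have hgg : ∀ y, g.toLinearMap (g.toLinearMap y) = g.toLinearMap y := fun y => by rw [hg, hg, hude]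
  have hinj : Function.Injective e.toLinearMap :=
    Function.Injective.of_comp (f := d.toLinearMap) (by rw [← LinearMap.coe_comp]; exact h.1)
  rcases hT.bijective_or_isNilpotent g with hb | hn
  · -- bijective idempotent = identity, so `e` is onto
    refine ⟨hinj, fun y => ⟨u.toLinearMap (d.toLinearMap y), ?_⟩⟩
    rw [← hg]; exact hb.1 (hgg y)
  · -- nilpotent idempotent = 0, contradicting `d g e = d e` bijective on `S ≠ 0`
    exfalso
    obtain ⟨n, hn⟩ := hn
    have hpow : ∀ m : ℕ, ∀ y, (g.toLinearMap ^ (m + 1)) y = g.toLinearMap y := by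
      intro m
      induction m with
      | zero => intro y; rw [zero_add, pow_one]
      | succ m ih => intro y; rw [pow_succ, Module.End.mul_apply, ih, hgg]
    have hg0 : ∀ y, g.toLinearMap y = 0 := fun y => by
      rw [← hpow n y, pow_succ, Module.End.mul_apply, hn, LinearMap.zero_apply]
    obtain ⟨x, hx⟩ := exists_ne (0 : VS)
    apply hx
    have h1 : d.toLinearMap (g.toLinearMap (e.toLinearMap x)) = d.toLinearMap (e.toLinearMap x) := by rw [hg, hude]
    rw [hg0, map_zero] at h1
    exact h.1 (by rw [Hom.comp_toLinearMap, LinearMap.comp_apply, ← h1, map_zero])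

omit [FiniteDimensional ℚ VS] in
/-- … and then `d` is an isomorphism too. [cite: CattaniElZeinGriffithsLe2014, Thm. 3.2.18 and p. 270] -/
theorem IsIndecomposable.bijective_of_comp_bijective' [Nontrivial VS] (hT : HT.IsIndecomposable) (e : Hom HS HT)
    (d : Hom HT HS) (h : Function.Bijective (d.comp e).toLinearMap) : Function.Bijective d.toLinearMap := by
  have he := hT.bijective_of_comp_bijective e d h
  have hcomp : d.toLinearMap = (d.comp e).toLinearMap ∘ₗ ((LinearEquiv.ofBijective e.toLinearMap he).symm : VT →ₗ[ℚ] VS) :=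
    LinearMap.ext fun y => by simp [Hom.comp_toLinearMap]
  rw [hcomp, LinearMap.coe_comp]
  exact h.comp (LinearEquiv.ofBijective e.toLinearMap he).symm.bijective

end Summand

/-! ### §2 Projections of a decomposition and the exchange lemma -/

namespace SubMixedHodgeStructure

omit [FiniteDimensional ℚ V] in
/-- **`x = π_S x + π_{S'} x`** for `H = S ⊕ S'` (`projOfIsCompl S' S _` projects onto `S` along `S'`).
[cite: CattaniElZeinGriffithsLe2014, Thm. 3.2.18] -/
theorem coe_projOfIsCompl_add_coe_projOfIsCompl (S S' : SubMixedHodgeStructure H)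
    (h : IsCompl S.toSubmodule S'.toSubmodule) (x : V) :
    ((projOfIsCompl S' S h.symm).toLinearMap x : V) + ((projOfIsCompl S S' h).toLinearMap x : V) = x := by
  have hx : x ∈ S.toSubmodule ⊔ S'.toSubmodule := by rw [h.sup_eq_top]; exact Submodule.mem_top
  obtain ⟨s, hs, t, ht, rfl⟩ := Submodule.mem_sup.1 hx
  rw [map_add, map_add, projOfIsCompl_apply_of_mem_left S S' h hs, projOfIsCompl_apply_of_mem_left S' S h.symm ht,
    show s = ((⟨s, hs⟩ : S.toSubmodule) : V) from rfl, projOfIsCompl_apply_of_mem_right S' S h.symm ⟨s, hs⟩,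
    show t = ((⟨t, ht⟩ : S'.toSubmodule) : V) from rfl, projOfIsCompl_apply_of_mem_right S S' h ⟨t, ht⟩]
  simp

omit [FiniteDimensional ℚ V] in
/-- The kernel of the projection onto `S'` along `S` is `S`. [cite: CattaniElZeinGriffithsLe2014, Thm. 3.2.18] -/
theorem mem_of_projOfIsCompl_eq_zero (S S' : SubMixedHodgeStructure H) (h : IsCompl S.toSubmodule S'.toSubmodule)
    {x : V} (hx : (projOfIsCompl S S' h).toLinearMap x = 0) : x ∈ S.toSubmodule := by
  rw [← coe_projOfIsCompl_add_coe_projOfIsCompl S S' h x, hx, Submodule.coe_zero, add_zero]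
  exact Subtype.mem _

end SubMixedHodgeStructure

open SubMixedHodgeStructure

section Exchange

variable {S S' T T' : SubMixedHodgeStructure H}

/-- **Exchange lemma.** For two decompositions `H = S ⊕ S' = T ⊕ T'` into sub-MHS with `S`, `T`, `T'`
indecomposable, the projection onto `T` (along `T'`) or the projection onto `T'` (along `T`) restricts to an
isomorphism `S ⥲ T`, resp. `S ⥲ T'` (`id_S = p_S π_T ι_S + p_S π_{T'} ι_S` in the local ring `End(S)`, then §1).
[cite: CattaniElZeinGriffithsLe2014, Thm. 3.2.18 and p. 270] -/
theorem IsIndecomposable.bijective_proj_comp_subtype_or (hS : S.toMixedHodgeStructure.IsIndecomposable)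
    (hT : T.toMixedHodgeStructure.IsIndecomposable) (hT' : T'.toMixedHodgeStructure.IsIndecomposable)
    (hSS' : IsCompl S.toSubmodule S'.toSubmodule) (hTT' : IsCompl T.toSubmodule T'.toSubmodule) :
    Function.Bijective ((projOfIsCompl T' T hTT'.symm).comp S.subtype).toLinearMap ∨
      Function.Bijective ((projOfIsCompl T T' hTT').comp S.subtype).toLinearMap := by
  haveI := hS.nontrivial
  let pS : Hom H S.toMixedHodgeStructure := projOfIsCompl S' S hSS'.symm
  let f₁ : Hom S.toMixedHodgeStructure S.toMixedHodgeStructure :=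
    (pS.comp T.subtype).comp ((projOfIsCompl T' T hTT'.symm).comp S.subtype)
  let f₂ : Hom S.toMixedHodgeStructure S.toMixedHodgeStructure :=
    (pS.comp T'.subtype).comp ((projOfIsCompl T T' hTT').comp S.subtype)
  have hsum : (f₁.add f₂).toLinearMap = LinearMap.id := by
    refine LinearMap.ext fun x => ?_
    rw [Hom.add_toLinearMap, LinearMap.add_apply, LinearMap.id_apply]
    change pS.toLinearMap (T.toSubmodule.subtype ((projOfIsCompl T' T hTT'.symm).toLinearMap (S.toSubmodule.subtype x))) +
      pS.toLinearMap (T'.toSubmodule.subtype ((projOfIsCompl T T' hTT').toLinearMap (S.toSubmodule.subtype x))) = x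
    rw [← map_add, Submodule.coe_subtype, Submodule.coe_subtype, Submodule.coe_subtype,
      coe_projOfIsCompl_add_coe_projOfIsCompl T T' hTT']
    exact projOfIsCompl_apply_of_mem_right S' S hSS'.symm x
  rcases hS.bijective_or_bijective_of_bijective_add f₁ f₂ (by rw [hsum]; exact Function.bijective_id) with h1 | h2
  · exact Or.inl (hT.bijective_of_comp_bijective _ (pS.comp T.subtype) h1)
  · exact Or.inr (hT'.bijective_of_comp_bijective _ (pS.comp T'.subtype) h2)

/-! ### §3 Consequences: the two-summand Krull–Schmidt theorem -/

/-- **If the projection `S → T` (along `T'`) is an isomorphism then `H = S ⊕ T'`.** [cite: CattaniElZeinGriffithsLe2014, Thm. 3.2.18 and p. 270] -/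
theorem isCompl_of_bijective_proj_comp_subtype (hTT' : IsCompl T.toSubmodule T'.toSubmodule)
    (h : Function.Bijective ((projOfIsCompl T' T hTT'.symm).comp S.subtype).toLinearMap) :
    IsCompl S.toSubmodule T'.toSubmodule := by
  have hdisj : Disjoint S.toSubmodule T'.toSubmodule := by
    rw [disjoint_iff, eq_bot_iff]
    rintro x ⟨hxS, hxT'⟩
    have h0 : ((projOfIsCompl T' T hTT'.symm).comp S.subtype).toLinearMap ⟨x, hxS⟩ = 0 :=
      projOfIsCompl_apply_of_mem_left T' T hTT'.symm hxT'
    have hx := h.1 (h0.trans (map_zero _).symm)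
    rw [Submodule.mem_bot]; exact congrArg Subtype.val hx
  have hrank : finrank ℚ S.toSubmodule + finrank ℚ T'.toSubmodule = finrank ℚ V := by
    rw [(LinearEquiv.ofBijective _ h).finrank_eq]; exact Submodule.finrank_add_eq_of_isCompl hTT'
  refine ⟨hdisj, codisjoint_iff.2 (Submodule.eq_top_of_finrank_eq ?_)⟩
  have hsup := Submodule.finrank_sup_add_finrank_inf_eq S.toSubmodule T'.toSubmodule
  rw [hdisj.eq_bot, finrank_bot, add_zero] at hsup
  rw [hsup, hrank]

/-- **Two complements of the same sub-MHS are isomorphic**: if `H = S ⊕ S' = S ⊕ T'` then the projection onto `T'`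
along `S` restricts to an isomorphism `S' ⥲ T'` (both are `≅ H/S`). [cite: CattaniElZeinGriffithsLe2014, Thm. 3.2.18] -/
theorem bijective_proj_comp_subtype_of_isCompl_of_isCompl (hSS' : IsCompl S.toSubmodule S'.toSubmodule)
    (hST' : IsCompl S.toSubmodule T'.toSubmodule) :
    Function.Bijective ((projOfIsCompl S T' hST').comp S'.subtype).toLinearMap := by
  have hinj : Function.Injective ((projOfIsCompl S T' hST').comp S'.subtype).toLinearMap := by
    rw [← LinearMap.ker_eq_bot, eq_bot_iff]
    intro x hx
    rw [LinearMap.mem_ker] at hx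
    have hxS : (x : V) ∈ S.toSubmodule := mem_of_projOfIsCompl_eq_zero S T' hST' hx
    rw [Submodule.mem_bot]
    exact Subtype.ext ((Submodule.mem_bot ℚ).1 (hSS'.disjoint.le_bot ⟨hxS, x.2⟩))
  have hrank : finrank ℚ S'.toSubmodule = finrank ℚ T'.toSubmodule := by
    have h1 := Submodule.finrank_add_eq_of_isCompl hSS'
    have h2 := Submodule.finrank_add_eq_of_isCompl hST'
    omega
  exact ⟨hinj, (LinearMap.injective_iff_surjective_of_finrank_eq_finrank hrank).1 hinj⟩

/-- **Krull–Schmidt for two summands.** If `H = S ⊕ S' = T ⊕ T'` with `S`, `T`, `T'` indecomposable sub-MHS, then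
`S ≅ T` and `S' ≅ T'`, or `S ≅ T'` and `S' ≅ T` (isomorphisms of mixed Hodge structures).
[cite: CattaniElZeinGriffithsLe2014, Thm. 3.2.18 and p. 270] -/
theorem krullSchmidt_two (hS : S.toMixedHodgeStructure.IsIndecomposable) (hT : T.toMixedHodgeStructure.IsIndecomposable)
    (hT' : T'.toMixedHodgeStructure.IsIndecomposable) (hSS' : IsCompl S.toSubmodule S'.toSubmodule)
    (hTT' : IsCompl T.toSubmodule T'.toSubmodule) :
    ((∃ e : Hom S.toMixedHodgeStructure T.toMixedHodgeStructure, Function.Bijective e.toLinearMap) ∧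
      ∃ e' : Hom S'.toMixedHodgeStructure T'.toMixedHodgeStructure, Function.Bijective e'.toLinearMap) ∨
    ((∃ e : Hom S.toMixedHodgeStructure T'.toMixedHodgeStructure, Function.Bijective e.toLinearMap) ∧
      ∃ e' : Hom S'.toMixedHodgeStructure T.toMixedHodgeStructure, Function.Bijective e'.toLinearMap) := by
  rcases hS.bijective_proj_comp_subtype_or hT hT' hSS' hTT' with h | h
  · exact Or.inl ⟨⟨_, h⟩, _, bijective_proj_comp_subtype_of_isCompl_of_isCompl hSS'
      (isCompl_of_bijective_proj_comp_subtype hTT' h)⟩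
  · exact Or.inr ⟨⟨_, h⟩, _, bijective_proj_comp_subtype_of_isCompl_of_isCompl hSS'
      (isCompl_of_bijective_proj_comp_subtype hTT'.symm h)⟩

/-- In particular the unordered pair of dimensions `{dim S, dim S'}` equals `{dim T, dim T'}`.
[cite: CattaniElZeinGriffithsLe2014, Thm. 3.2.18 and p. 270] -/
theorem finrank_eq_or_of_isCompl_isCompl (hS : S.toMixedHodgeStructure.IsIndecomposable)
    (hT : T.toMixedHodgeStructure.IsIndecomposable) (hT' : T'.toMixedHodgeStructure.IsIndecomposable)
    (hSS' : IsCompl S.toSubmodule S'.toSubmodule) (hTT' : IsCompl T.toSubmodule T'.toSubmodule) :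
    (finrank ℚ S.toSubmodule = finrank ℚ T.toSubmodule ∧ finrank ℚ S'.toSubmodule = finrank ℚ T'.toSubmodule) ∨
      (finrank ℚ S.toSubmodule = finrank ℚ T'.toSubmodule ∧ finrank ℚ S'.toSubmodule = finrank ℚ T.toSubmodule) := by
  rcases krullSchmidt_two hS hT hT' hSS' hTT' with ⟨⟨e, he⟩, e', he'⟩ | ⟨⟨e, he⟩, e', he'⟩
  · exact Or.inl ⟨(LinearEquiv.ofBijective _ he).finrank_eq, (LinearEquiv.ofBijective _ he').finrank_eq⟩
  · exact Or.inr ⟨(LinearEquiv.ofBijective _ he).finrank_eq, (LinearEquiv.ofBijective _ he').finrank_eq⟩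

end Exchange

end MixedHodgeStructure

end Literature.AlgebraicGeometry.Motives
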